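import Summits.HodgeConjecture.HodgeConjecture.Theorems.K2E1BorelWeightAverage                   -- ★ AVG (K2E4-p11 g3): `coveringSum_fibreWeight_restrict_eq_of`; brings ★ engine `lintegral_enorm_mul_fibreWeight_eq`, `measurable_fibreWeight`, ★ `CoveringWeightsBochner`
import Mathlib.MeasureTheory.Integral.MeanInequalities                                            -- Mathlib `ENNReal.lintegral_mul_le_Lp_mul_Lq` (Hölder)
import HarnessLib

/-!
# FIBRE JENSEN for the Borel constant term under a `B(F)♯`-covering weight:
# `‖F_B(g)‖² ≤ (ν𝓕)⁻¹·∫_𝓕 ‖F(u g)‖² dν(u)` and `∫⁻ β·w·‖F_B‖² dν_G ≤ ∫⁻ β·w·‖F‖² dν_G`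

Campaign «EIS-R7-BL-SPH-2∕3», deal `hcnst` half (ii) «P2b-side, general class» (dealer K2E1-plan (g6) (17)∕(21)), file J of its road (letter-free but for the structural unfolding letters of
★ AVG, EVERY rank `N`).  THEOREMS ONLY (no `def`, no `instance`, no notation, no named-fact hypothesis, no `sorry`); lane `--supports stmt-HodgeConjecture-24833 --as helper`
(count-neutral).  Closes no socket.

WHY.  For an L²-CLASS `f ∈ 𝓗_k(Z_c)` the fibre average `Ψ = (⇑f ∘ π)_B` of its lift must be shown square-integrable against the unfolded weight `β·𝟙_{c<H}·H^{−2k}·ν_G` BEFORE any Bochner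
identity can be applied to it (★ AVG's `integral_wt_smul_borelConstantTerm_eq_of` is an identity of Bochner integrals and needs an `L¹` hypothesis on the un-averaged side only).  This file
gives the `L²` control as an inequality of lower integrals, with NO integrability hypothesis: pointwise Jensen (Cauchy–Schwarz on the probability measure `(ν𝓕)⁻¹ν|_𝓕`, Mathlib Hölder
`ENNReal.lintegral_mul_le_Lp_mul_Lq` at `(2, 2)`) and then the same unfolding∕weight-independence steps as ★ AVG's proof (★ engine `lintegral_enorm_mul_fibreWeight_eq`, ★
`coveringSum_fibreWeight_restrict_eq_of`, ★ `lintegral_enorm_mul_eq_of_coveringSum_eq_one`) applied to the Borel `B(F)♯`-invariant function `Θ = w·F²` (`‖Θ‖ = w·‖F‖²`), for any weight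
`w : G(𝔸) → ℝ≥0` that is left-`N(𝔸)`- and `B(F)♯`-invariant (e.g. `𝟙_{c<H}·H^{−2k}`).

* §1 `enorm_toReal_inv_of_ne` (bookkeeping), **`enorm_borelConstantTerm_sq_le`** (pointwise Jensen).
* §2 **`lintegral_mul_enorm_borelConstantTerm_sq_le_of`** (the integrated inequality under ★ AVG's structural letters `νG νN hconj h𝓕 h𝓕₀ h𝓕top hβ`).
HONEST LABEL: HC_CM is proved only modulo the 7 printed citations (2 remaining named inputs: hLiu418 = `stmt-HodgeConjecture-24832`, h413 = `stmt-HodgeConjecture-24833`)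
until rung 0 closes; this file asserts no named fact and closes no socket.
References: [MoeglinWaldspurger1995] I.2.6, II.1.7 · [Garrett2018] §1.10 · [Folland1995] §2.6 (Weil's formula).
-/

set_option autoImplicit false
-- the mandated namespace repeats the single-problem summit's segment (`HodgeConjecture.HodgeConjecture`)
set_option linter.dupNamespace false

noncomputable section

open MeasureTheory MeasureTheory.Measure Set NumberField IsDedekindDomain
open scoped ENNReal NNReal
open Literature.MeasureTheory.Group Literature.NumberTheory
open Literature.NumberTheory.Automorphic Literature.NumberTheory.Automorphic.UnitaryGroup
open Summit.HodgeConjecture.HodgeConjecture.Cruxes.H413.K2E1IntertwiningAdjointEngine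
open Summit.HodgeConjecture.HodgeConjecture.Cruxes.H413.K2E1IntertwiningAdjoint
open Summit.HodgeConjecture.HodgeConjecture.Cruxes.H413.K2E1IntertwinedSectionInvariance
open Summit.HodgeConjecture.HodgeConjecture.Cruxes.H413.K2E1BorelWeightAverage (coveringSum_fibreWeight_restrict_eq_of)

namespace Summit.HodgeConjecture.HodgeConjecture.Cruxes.H413.K2E1BorelConstantTermJensenU

variable {F E : Type} [Field F] [NumberField F] [Field E] [NumberField E] [Algebra F E] {c : E ≃ₐ[F] E} {N : ℕ}

/-! ## §1 Pointwise Jensen on the fibre -/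

/-- `‖(ν𝓕).toReal⁻¹‖ₑ = (ν𝓕)⁻¹` for `0 < ν𝓕 < ∞`. [folklore] -/
theorem enorm_toReal_inv_of_ne {a : ℝ≥0∞} (h0 : a ≠ 0) (htop : a ≠ ∞) : ‖(a.toReal⁻¹ : ℝ)‖ₑ = a⁻¹ := by
  rw [Real.enorm_eq_ofReal (inv_nonneg.2 ENNReal.toReal_nonneg), ENNReal.ofReal_inv_of_pos (ENNReal.toReal_pos h0 htop), ENNReal.ofReal_toReal htop]

variable [MeasurableSpace (quasiSplit F E c N).Adelic] [BorelSpace (quasiSplit F E c N).Adelic]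

/-- **POINTWISE FIBRE JENSEN**: `‖F_B(g)‖² ≤ (ν𝓕)⁻¹ · ∫⁻_𝓕 ‖F(u g)‖² dν(u)` for Borel `F`, `0 < ν(𝓕) < ∞` — the norm of the average is at most the average of the norms (Mathlib
`enorm_integral_le_lintegral_enorm`), and Cauchy–Schwarz `(∫⁻_𝓕 ‖F(u g)‖)² ≤ ν(𝓕)·∫⁻_𝓕 ‖F(u g)‖²` (Mathlib Hölder at `(2,2)`). [cite: MoeglinWaldspurger1995, I.2.6] [cite: Folland1995, §2.6] -/
theorem enorm_borelConstantTerm_sq_le (νN : Measure ↥(adelicUnipotent F E c N)) {𝓕 : Set ↥(adelicUnipotent F E c N)} (h𝓕₀ : νN 𝓕 ≠ 0) (h𝓕top : νN 𝓕 ≠ ∞)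
    {Φ : (quasiSplit F E c N).Adelic → ℂ} (hΦm : Measurable Φ) (g : (quasiSplit F E c N).Adelic) :
    ‖borelConstantTerm νN 𝓕 Φ g‖ₑ ^ 2 ≤ (νN 𝓕)⁻¹ * ∫⁻ u in 𝓕, ‖Φ ((u : (quasiSplit F E c N).Adelic) * g)‖ₑ ^ 2 ∂νN := by
  have hgm : AEMeasurable (fun u : ↥(adelicUnipotent F E c N) => ‖Φ ((u : (quasiSplit F E c N).Adelic) * g)‖ₑ) (νN.restrict 𝓕) :=
    (hΦm.comp (measurable_subtype_coe.mul_const g)).enorm.aemeasurable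
  -- the norm of the average
  have hI : ‖∫ u in 𝓕, Φ ((u : (quasiSplit F E c N).Adelic) * g) ∂νN‖ₑ ≤ ∫⁻ u in 𝓕, ‖Φ ((u : (quasiSplit F E c N).Adelic) * g)‖ₑ ∂νN :=
    enorm_integral_le_lintegral_enorm _
  -- Cauchy–Schwarz on `ν|_𝓕`
  have hCS : (∫⁻ u in 𝓕, ‖Φ ((u : (quasiSplit F E c N).Adelic) * g)‖ₑ ∂νN) ^ 2 ≤ νN 𝓕 * ∫⁻ u in 𝓕, ‖Φ ((u : (quasiSplit F E c N).Adelic) * g)‖ₑ ^ 2 ∂νN := by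
    have h := ENNReal.lintegral_mul_le_Lp_mul_Lq (νN.restrict 𝓕) Real.HolderConjugate.two_two aemeasurable_const hgm
      (f := fun _ => (1 : ℝ≥0∞)) (g := fun u => ‖Φ ((u : (quasiSplit F E c N).Adelic) * g)‖ₑ)
    simp only [Pi.mul_apply, one_mul, ENNReal.one_rpow, setLIntegral_const] at h
    have h3 : ((νN 𝓕) ^ (1 / (2 : ℝ)) * (∫⁻ u in 𝓕, ‖Φ ((u : (quasiSplit F E c N).Adelic) * g)‖ₑ ^ (2 : ℝ) ∂νN) ^ (1 / (2 : ℝ))) ^ 2 =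
        νN 𝓕 * ∫⁻ u in 𝓕, ‖Φ ((u : (quasiSplit F E c N).Adelic) * g)‖ₑ ^ 2 ∂νN := by
      rw [← ENNReal.mul_rpow_of_nonneg _ _ (by norm_num : (0 : ℝ) ≤ 1 / 2), ← ENNReal.rpow_two, ← ENNReal.rpow_mul,
        show (1 / (2 : ℝ)) * 2 = 1 by norm_num, ENNReal.rpow_one]
      simp only [ENNReal.rpow_two]
    calc (∫⁻ u in 𝓕, ‖Φ ((u : (quasiSplit F E c N).Adelic) * g)‖ₑ ∂νN) ^ 2
        ≤ ((νN 𝓕) ^ (1 / (2 : ℝ)) * (∫⁻ u in 𝓕, ‖Φ ((u : (quasiSplit F E c N).Adelic) * g)‖ₑ ^ (2 : ℝ) ∂νN) ^ (1 / (2 : ℝ))) ^ 2 := pow_le_pow_left' h 2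
      _ = _ := h3
  -- assemble
  rw [borelConstantTerm_def, enorm_smul, enorm_toReal_inv_of_ne h𝓕₀ h𝓕top, mul_pow]
  calc (νN 𝓕)⁻¹ ^ 2 * ‖∫ u in 𝓕, Φ ((u : (quasiSplit F E c N).Adelic) * g) ∂νN‖ₑ ^ 2
      ≤ (νN 𝓕)⁻¹ ^ 2 * (νN 𝓕 * ∫⁻ u in 𝓕, ‖Φ ((u : (quasiSplit F E c N).Adelic) * g)‖ₑ ^ 2 ∂νN) := by gcongr; exact (pow_le_pow_left' hI 2).trans hCS
    _ = (νN 𝓕)⁻¹ * ∫⁻ u in 𝓕, ‖Φ ((u : (quasiSplit F E c N).Adelic) * g)‖ₑ ^ 2 ∂νN := by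
        rw [sq, mul_assoc, ← mul_assoc ((νN 𝓕)⁻¹) (νN 𝓕), ENNReal.inv_mul_cancel h𝓕₀ h𝓕top, one_mul]

/-! ## §2 The integrated inequality under the covering weight -/

/-- **FIBRE JENSEN, INTEGRATED AGAINST THE COVERING WEIGHT**: for Borel left-`B(F)♯`-invariant `F : G(𝔸) → ℂ` and a Borel weight `w : G(𝔸) → ℝ≥0` invariant under left `N(𝔸)` and `B(F)♯`,
**`∫⁻ β·(w·‖F_B‖²) dν_G ≤ ∫⁻ β·(w·‖F‖²) dν_G`** — under ★ AVG's structural letters (`ν_N` Haar inversion-invariant and `B(F)`-conjugation invariant `hconj`, `𝓕` a fundamental domain of `N(F)` of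
finite non-zero measure, `β` a `B(F)♯`-covering weight); NO integrability hypothesis.  Pointwise Jensen (§1), then ★ `lintegral_enorm_mul_fibreWeight_eq` on `Θ = w·F²` and the covering-sum
identity ★ `coveringSum_fibreWeight_restrict_eq_of` with ★ `lintegral_enorm_mul_eq_of_coveringSum_eq_one`. [cite: MoeglinWaldspurger1995, II.1.7] [cite: Garrett2018, §1.10] -/
theorem lintegral_mul_enorm_borelConstantTerm_sq_le_of
    (νG : Measure (quasiSplit F E c N).Adelic) [νG.IsHaarMeasure]
    (νN : Measure ↥(adelicUnipotent F E c N)) [νN.IsHaarMeasure] [νN.IsInvInvariant]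
    (hconj : ∀ b₀ (hb₀ : b₀ ∈ borelU (c : E →+* E) ((StdForm.antidiagonal N).over E)),
      νN.map (fun v : ↥(adelicUnipotent F E c N) => (⟨((quasiSplit F E c N).toAdelic b₀)⁻¹ * (v : (quasiSplit F E c N).Adelic) * (quasiSplit F E c N).toAdelic b₀,
        conj_mem_adelicUnipotent ((K2E1PseudoEisensteinConstantTermU.toAdelic_mem_borelAdelic_iff b₀).2 hb₀) v.2⟩ : ↥(adelicUnipotent F E c N))) = νN)
    {𝓕 : Set ↥(adelicUnipotent F E c N)} (h𝓕 : IsFundamentalDomain ↥(rationalUnipotent F E c N) 𝓕 νN) (h𝓕₀ : νN 𝓕 ≠ 0) (h𝓕top : νN 𝓕 ≠ ∞)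
    {β : (quasiSplit F E c N).Adelic → ℝ≥0∞} (hβ : IsCoveringWeight ↥((arithmeticBorel F E c N).map (quasiSplit F E c N).arithmeticSubgroup.subtype) β)
    {Fn : (quasiSplit F E c N).Adelic → ℂ} (hFm : Measurable Fn)
    (hFB : ∀ b ∈ arithmeticBorel F E c N, ∀ x : (quasiSplit F E c N).Adelic, Fn ((b : (quasiSplit F E c N).Adelic) * x) = Fn x)
    {w : (quasiSplit F E c N).Adelic → ℝ≥0} (hwm : Measurable w)
    (hwN : ∀ (u : ↥(adelicUnipotent F E c N)) (g : (quasiSplit F E c N).Adelic), w ((u : (quasiSplit F E c N).Adelic) * g) = w g)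
    (hwB : ∀ b ∈ arithmeticBorel F E c N, ∀ x : (quasiSplit F E c N).Adelic, w ((b : (quasiSplit F E c N).Adelic) * x) = w x) :
    ∫⁻ g, β g * ((w g : ℝ≥0∞) * ‖borelConstantTerm νN 𝓕 Fn g‖ₑ ^ 2) ∂νG ≤ ∫⁻ g, β g * ((w g : ℝ≥0∞) * ‖Fn g‖ₑ ^ 2) ∂νG := by
  classical
  haveI := secondCountableTopology_adeleRing E
  haveI := locallyCompactSpace_adeleRing' E
  haveI := t2Space_adeleRing_of_numberField E
  haveI : SecondCountableTopology (quasiSplit F E c N).Adelic := inferInstanceAs (SecondCountableTopology (adelic F E c N ((StdForm.antidiagonal N).over E)))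
  haveI : LocallyCompactSpace (quasiSplit F E c N).Adelic := inferInstanceAs (LocallyCompactSpace (adelic F E c N ((StdForm.antidiagonal N).over E)))
  haveI : SecondCountableTopology ↥(adelicUnipotent F E c N) := TopologicalSpace.Subtype.secondCountableTopology _
  have hNcl : IsClosed ((adelicUnipotent F E c N : Set (quasiSplit F E c N).Adelic)) := by
    change IsClosed (⇑(adelicVal F E c N ((StdForm.antidiagonal N).over E)) ⁻¹'
      ((upperUnitriangular (Fin N) (AdeleRing (𝓞 E) E) : Subgroup (GL (Fin N) (AdeleRing (𝓞 E) E))) : Set (GL (Fin N) (AdeleRing (𝓞 E) E))))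
    exact (isClosed_upperUnitriangular (R := AdeleRing (𝓞 E) E)).preimage continuous_subtype_val
  haveI : LocallyCompactSpace ↥(adelicUnipotent F E c N) := hNcl.locallyCompactSpace
  haveI : SFinite (νN.restrict 𝓕) := inferInstance
  haveI : Countable ↥((arithmeticBorel F E c N).map (quasiSplit F E c N).arithmeticSubgroup.subtype) := by
    obtain ⟨e, -⟩ := exists_equiv_torus_prod_rationalUnipotent (F := F) (E := E) (c := c) (N := N)
    haveI := countable_mapTorus (F := F) (E := E) (c := c) (N := N)
    haveI := countable_rationalUnipotent' (F := F) (E := E) (c := c) (N := N)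
    exact Countable.of_equiv _ e
  haveI := K2E1IntertwiningAdjointEngine.measurableConstSMul_subgroup ((arithmeticBorel F E c N).map (quasiSplit F E c N).arithmeticSubgroup.subtype)
  haveI := K2E1IntertwiningAdjointEngine.smulInvariantMeasure_subgroup ((arithmeticBorel F E c N).map (quasiSplit F E c N).arithmeticSubgroup.subtype) νG
  have hβm := hβ.measurable
  -- the `𝓕`-fibre weight and its normalised covering sum
  set μU : Measure ↥(adelicUnipotent F E c N) := νN.restrict 𝓕 with hμU
  set B : (quasiSplit F E c N).Adelic → ℝ≥0∞ := fun y => ∫⁻ u, β (((u : (quasiSplit F E c N).Adelic))⁻¹ * y) ∂μU with hBdef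
  have hBm : Measurable B := measurable_fibreWeight (adelicUnipotent F E c N) μU hβm
  have hBsum : ∀ y, coveringSum ↥((arithmeticBorel F E c N).map (quasiSplit F E c N).arithmeticSubgroup.subtype) B y = νN 𝓕 :=
    fun y => coveringSum_fibreWeight_restrict_eq_of νN hconj h𝓕 hβ y
  have h₁ : ∀ y, coveringSum ↥((arithmeticBorel F E c N).map (quasiSplit F E c N).arithmeticSubgroup.subtype) (fun y => (νN 𝓕)⁻¹ * B y) y = 1 := fun y => by
    rw [coveringSum_const_mul, hBsum, ENNReal.inv_mul_cancel h𝓕₀ h𝓕top]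
  have hB1m : Measurable fun y => (νN 𝓕)⁻¹ * B y := measurable_const.mul hBm
  -- the test function `Θ = w·F²`, Borel and `B(F)♯`-invariant, with `‖Θ‖ = w·‖F‖²`
  set Θ : (quasiSplit F E c N).Adelic → ℂ := fun g => (((w g : ℝ)) : ℂ) * Fn g ^ 2 with hΘ
  have hΘm : Measurable Θ := (Complex.measurable_ofReal.comp (measurable_subtype_coe.comp hwm)).mul (hFm.pow_const 2)
  have hΘinv : ∀ (γ : ↥((arithmeticBorel F E c N).map (quasiSplit F E c N).arithmeticSubgroup.subtype)) (x : (quasiSplit F E c N).Adelic), Θ (γ • x) = Θ x := by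
    rintro ⟨_, ⟨b, hb, rfl⟩⟩ x
    change (((w (((b : (quasiSplit F E c N).arithmeticSubgroup) : (quasiSplit F E c N).Adelic) * x) : ℝ)) : ℂ) *
        Fn (((b : (quasiSplit F E c N).arithmeticSubgroup) : (quasiSplit F E c N).Adelic) * x) ^ 2 = (((w x : ℝ)) : ℂ) * Fn x ^ 2
    rw [hwB b hb x, hFB b hb x]
  have hΘnorm : ∀ g : (quasiSplit F E c N).Adelic, ‖Θ g‖ₑ = (w g : ℝ≥0∞) * ‖Fn g‖ₑ ^ 2 := fun g => by
    have h1 : ‖(((w g : ℝ)) : ℂ)‖ₑ = (w g : ℝ≥0∞) := by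
      rw [enorm_eq_nnnorm, Complex.nnnorm_real, NNReal.nnnorm_eq]
    show ‖(((w g : ℝ)) : ℂ) * Fn g ^ 2‖ₑ = _
    rw [enorm_mul, enorm_pow, h1]
  -- (1) pointwise Jensen, the weight pulled into the fibre integral
  have hpt : ∀ g : (quasiSplit F E c N).Adelic, β g * ((w g : ℝ≥0∞) * ‖borelConstantTerm νN 𝓕 Fn g‖ₑ ^ 2) ≤
      (νN 𝓕)⁻¹ * (β g * ∫⁻ u, ‖Θ ((u : (quasiSplit F E c N).Adelic) * g)‖ₑ ∂μU) := by
    intro g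
    have hJ := enorm_borelConstantTerm_sq_le νN h𝓕₀ h𝓕top hFm g
    have hin : ∫⁻ u, ‖Θ ((u : (quasiSplit F E c N).Adelic) * g)‖ₑ ∂μU = (w g : ℝ≥0∞) * ∫⁻ u in 𝓕, ‖Fn ((u : (quasiSplit F E c N).Adelic) * g)‖ₑ ^ 2 ∂νN := by
      rw [hμU, ← lintegral_const_mul' _ _ ENNReal.coe_ne_top]
      exact lintegral_congr fun u => by rw [hΘnorm, hwN u g]
    rw [hin]
    calc β g * ((w g : ℝ≥0∞) * ‖borelConstantTerm νN 𝓕 Fn g‖ₑ ^ 2)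
        ≤ β g * ((w g : ℝ≥0∞) * ((νN 𝓕)⁻¹ * ∫⁻ u in 𝓕, ‖Fn ((u : (quasiSplit F E c N).Adelic) * g)‖ₑ ^ 2 ∂νN)) := by gcongr
      _ = (νN 𝓕)⁻¹ * (β g * ((w g : ℝ≥0∞) * ∫⁻ u in 𝓕, ‖Fn ((u : (quasiSplit F E c N).Adelic) * g)‖ₑ ^ 2 ∂νN)) := by ring
  -- (2) the unfolded fibre integral is `∫⁻ ‖Θ‖·B_𝓕`, and weight independence replaces `(ν𝓕)⁻¹B_𝓕` by `β`
  have hE : ∫⁻ g, β g * ∫⁻ u, ‖Θ ((u : (quasiSplit F E c N).Adelic) * g)‖ₑ ∂μU ∂νG = νN 𝓕 * ∫⁻ g, ‖Θ g‖ₑ * β g ∂νG := by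
    rw [← lintegral_enorm_mul_fibreWeight_eq νG (adelicUnipotent F E c N) μU hβm hΘm,
      ← lintegral_enorm_mul_eq_of_coveringSum_eq_one νG hΘm.stronglyMeasurable hΘinv (β₁ := fun y => (νN 𝓕)⁻¹ * B y) (β₂ := β) hB1m hβm h₁ hβ.coveringSum_eq]
    have hm : Measurable fun g => ‖Θ g‖ₑ * ((νN 𝓕)⁻¹ * B g) := hΘm.enorm.mul hB1m
    rw [← lintegral_const_mul _ hm]
    refine lintegral_congr fun g => ?_
    rw [← mul_assoc, mul_comm (νN 𝓕), mul_assoc, ← mul_assoc (νN 𝓕), ENNReal.mul_inv_cancel h𝓕₀ h𝓕top, one_mul]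
  -- (3) assemble
  calc ∫⁻ g, β g * ((w g : ℝ≥0∞) * ‖borelConstantTerm νN 𝓕 Fn g‖ₑ ^ 2) ∂νG
      ≤ ∫⁻ g, (νN 𝓕)⁻¹ * (β g * ∫⁻ u, ‖Θ ((u : (quasiSplit F E c N).Adelic) * g)‖ₑ ∂μU) ∂νG := lintegral_mono hpt
    _ = (νN 𝓕)⁻¹ * (νN 𝓕 * ∫⁻ g, ‖Θ g‖ₑ * β g ∂νG) := by rw [lintegral_const_mul' _ _ (ENNReal.inv_ne_top.2 h𝓕₀), hE]
    _ = ∫⁻ g, ‖Θ g‖ₑ * β g ∂νG := by rw [← mul_assoc, ENNReal.inv_mul_cancel h𝓕₀ h𝓕top, one_mul]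
    _ = ∫⁻ g, β g * ((w g : ℝ≥0∞) * ‖Fn g‖ₑ ^ 2) ∂νG := lintegral_congr fun g => by rw [hΘnorm, mul_comm]

end Summit.HodgeConjecture.HodgeConjecture.Cruxes.H413.K2E1BorelConstantTermJensenU

end
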